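import Summits.AnomalousDissipation.AnomalousDissipation.Theorems.NeutralTaylorWavesTaylorWaveQuasiSteadyHierarchyUnfold

/-!
# The two-slot structure of the ε-free hierarchy (line `windfibred`, rev 3)
# (crux stmt-AnomalousDissipation-16293, `NeutralTaylorWaves.TaylorWaveQuasiSteady`)

The algebraic backbone of any Leading/Induction treatment of the open core `stub_hierarchyW` (strategist s2,
`STRATEGY-CENSUS.md` §Decomposition D3, "two-slot identity"; here kernel-checked).  Write `X_a = (P_a, Q_a, c_a)` for the
level-`a` unknowns.  For every order `t` with `3 ≤ t ≤ N` the order-`t` equation of the hierarchy depends on the TOP TWO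
levels only through two FIXED linear operators built from the leading data `X_0, X_1`:

  `M_t = 𝓔′[X_t] + 𝓛♯[X_{t−1}] + G_t(X_1, …, X_{t−2})`        (`two_slot_identity`)

* `slotE` = `𝓔′[Z] = (P_0·k)∂_θP_Z + (P_Z·k)∂_θP_0 + k∂_θQ_Z − c_0k_2∂_θP_Z − c_Zk_2∂_θP_0` — the linearisation of the
  eikonal order `M_0` at `X_0` (fast convection + fast pressure + fast drift);
* `slotL` = `𝓛♯[Y] = (P_0·∇_x)P_Y + (P_Y·∇_x)P_0 + (P_1·k)∂_θP_Y + (P_Y·k)∂_θP_1 − |k|²∂_θ²P_Y + ∇_xQ_Y − c_0∂_{x_2}P_Y`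
  `− c_Y∂_{x_2}P_0 − c_1k_2∂_θP_Y − c_Yk_2∂_θP_1` — the linearisation of the order-one equation `M_1` at `(X_0, X_1)` (on the
  polarised subspace this is the linearised LEADING FAST PROBLEM at the leading wave, transport by the wave included);
* `lowerOrder` = `G_t` — slow/fast convection and drift among the levels `1 … t−2` and the viscous terms
  `−Δ_xP_{t−3} − [2(k·∇_x)∂_θ + (ΔG)∂_θ]P_{t−2}` (as compositions `sDeriv ∘ sDeriv`, `sDeriv ∘ fDeriv + fDeriv ∘ sDeriv`).
At `t = 2` the same split holds with Euler's correction (`two_slot_identity_two`): the quadratic self-term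
`B(X_1,X_1) = (P_1·k)∂_θP_1 − c_1k_2∂_θP_1` occurs ONCE in `M_2` but twice in `𝓛♯[X_1]`.
So beyond the leading orders the hierarchy is TRIANGULAR and LINEAR in the new unknowns with the SAME two operators at
every order — the induction step is "`𝓔′[X_t] + 𝓛♯[X_{t−1}] = −G_t`".  Pure algebra over `Unfold.hierarchyCoeff_of_le`
(peeling the first and last terms of the triangular sums).  Registered as the tools sub-stub `stub_hierarchyWTwoSlot`
(last theorem). [folklore]
-/

-- `Summit.<Summit>.<Problem>` is the tree's mandated summit-side namespace (CONVENTIONS §2); for this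
-- single-conjunct summit the two coincide, so the duplicate is deliberate.
set_option linter.dupNamespace false

noncomputable section

open scoped BigOperators
open Literature.Analysis.FunctionSpaces Literature.Analysis.FunctionSpaces.Torus

namespace Summit.AnomalousDissipation.AnomalousDissipation.Theorems.TaylorWaveQuasiSteady

/-! ## §1 The two slots and the lower-order remainder -/

/-- **The eikonal slot** `𝓔′[Z]`: linearisation of the order-`0` coefficient `hierarchyCoeff … 0` at the leading level
`(P_0, c_0)`, applied to a level `Z = (P_Z, Q_Z, c_Z)`:
`(P_0·k)∂_θP_Z + (P_Z·k)∂_θP_0 + k∂_θQ_Z − c_0 k_2∂_θP_Z − c_Z k_2∂_θP_0`. [folklore] -/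
def slotE (j : Fin 3 → ℤ) (G : UnitAddTorus (Fin 3) → ℝ) (P₀ : UnitAddTorus (Fin 4) → EuclideanSpace ℝ (Fin 3)) (c₀ : ℝ)
    (PZ : UnitAddTorus (Fin 4) → EuclideanSpace ℝ (Fin 3)) (QZ : UnitAddTorus (Fin 4) → ℝ) (cZ : ℝ)
    (y : UnitAddTorus (Fin 4)) : EuclideanSpace ℝ (Fin 3) :=
  (∑ l : Fin 3, (P₀ y) l • fDeriv j G l PZ y) + (∑ l : Fin 3, (PZ y) l • fDeriv j G l P₀ y)
    + WithLp.toLp 2 (fun i : Fin 3 => fDeriv j G i QZ y)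
    - c₀ • fDeriv j G 2 PZ y - cZ • fDeriv j G 2 P₀ y

/-- **The linearised order-one slot** `𝓛♯[Y]`: linearisation of the order-`1` coefficient `hierarchyCoeff … 1` at the two
leading levels `(P_0, c_0)`, `(P_1, c_1)`, applied to a level `Y = (P_Y, Q_Y, c_Y)`:
`(P_0·∇_x)P_Y + (P_Y·∇_x)P_0 + (P_1·k)∂_θP_Y + (P_Y·k)∂_θP_1 − ∑ᵢkᵢ∂_θ(kᵢ∂_θP_Y) + ∇_xQ_Y − c_0∂_{x_2}P_Y − c_Y∂_{x_2}P_0`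
`− c_1k_2∂_θP_Y − c_Yk_2∂_θP_1`. [folklore] -/
def slotL (j : Fin 3 → ℤ) (G : UnitAddTorus (Fin 3) → ℝ) (P₀ P₁ : UnitAddTorus (Fin 4) → EuclideanSpace ℝ (Fin 3)) (c₀ c₁ : ℝ)
    (PY : UnitAddTorus (Fin 4) → EuclideanSpace ℝ (Fin 3)) (QY : UnitAddTorus (Fin 4) → ℝ) (cY : ℝ)
    (y : UnitAddTorus (Fin 4)) : EuclideanSpace ℝ (Fin 3) :=
  (∑ l : Fin 3, (P₀ y) l • sDeriv l PY y) + (∑ l : Fin 3, (PY y) l • sDeriv l P₀ y)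
    + (∑ l : Fin 3, (P₁ y) l • fDeriv j G l PY y) + (∑ l : Fin 3, (PY y) l • fDeriv j G l P₁ y)
    - (∑ i : Fin 3, fDeriv j G i (fDeriv j G i PY) y)
    + WithLp.toLp 2 (fun i : Fin 3 => sDeriv i QY y)
    - c₀ • sDeriv 2 PY y - cY • sDeriv 2 P₀ y - c₁ • fDeriv j G 2 PY y - cY • fDeriv j G 2 P₁ y

/-- **The lower-order remainder** `G_t(X_1, …, X_{t−2})` of the order-`t` equation (`t ≥ 3`): slow convection and slow
drift among the levels `1 … t−2` (index `a + 1`, partner `t − 1 − (a+1)`), fast convection and fast drift among the levels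
`2 … t−2` (index `a + 2`, partner `t − (a+2)`), and the viscous terms `−Δ_x P_{t−3} − (∂ᵢ(kᵢ∂_θ·) + kᵢ∂_θ∂ᵢ) P_{t−2}`. [folklore] -/
def lowerOrder (j : Fin 3 → ℤ) (G : UnitAddTorus (Fin 3) → ℝ) (P : ℕ → UnitAddTorus (Fin 4) → EuclideanSpace ℝ (Fin 3))
    (c : ℕ → ℝ) (t : ℕ) (y : UnitAddTorus (Fin 4)) : EuclideanSpace ℝ (Fin 3) :=
  (∑ a ∈ Finset.range (t - 2), ∑ l : Fin 3, (P (a + 1) y) l • sDeriv l (P (t - 1 - (a + 1))) y)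
    + (∑ a ∈ Finset.range (t - 3), ∑ l : Fin 3, (P (a + 1 + 1) y) l • fDeriv j G l (P (t - (a + 1 + 1))) y)
    - (∑ i : Fin 3, sDeriv i (sDeriv i (P (t - 3))) y)
    - (∑ i : Fin 3, (sDeriv i (fDeriv j G i (P (t - 2))) y + fDeriv j G i (sDeriv i (P (t - 2))) y))
    - (∑ a ∈ Finset.range (t - 2), c (a + 1) • sDeriv 2 (P (t - 1 - (a + 1))) y)
    - (∑ a ∈ Finset.range (t - 3), c (a + 1 + 1) • fDeriv j G 2 (P (t - (a + 1 + 1))) y)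

/-! ## §2 The identities -/

section TwoSlot

variable (j : Fin 3 → ℤ) (G : UnitAddTorus (Fin 3) → ℝ) (f : UnitAddTorus (Fin 3) → EuclideanSpace ℝ (Fin 3)) (N : ℕ)
  (P : ℕ → UnitAddTorus (Fin 4) → EuclideanSpace ℝ (Fin 3)) (Q : ℕ → UnitAddTorus (Fin 4) → ℝ) (c : ℕ → ℝ)

/-- `toLp` of a pointwise sum of coordinate functions splits. [folklore] -/
theorem toLp_add_fun (A B : Fin 3 → ℝ) :
    WithLp.toLp 2 (fun i : Fin 3 => A i + B i) = WithLp.toLp 2 A + WithLp.toLp 2 B :=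
  WithLp.toLp_add 2 A B

/-- Peeling the first and the last term of a triangular sum of length `t ≥ 2`. [folklore] -/
theorem sum_range_peel {M : Type*} [AddCommMonoid M] (t : ℕ) (ht : 2 ≤ t) (g : ℕ → M) :
    ∑ a ∈ Finset.range t, g a = g 0 + (∑ a ∈ Finset.range (t - 2), g (a + 1)) + g (t - 1) := by
  obtain ⟨r, rfl⟩ : ∃ r, t = r + 2 := ⟨t - 2, by omega⟩
  rw [Finset.sum_range_succ, Finset.sum_range_succ', Nat.add_sub_cancel]
  rw [show r + 2 - 1 = r + 1 by omega]
  abel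

/-- **The two-slot identity** (`3 ≤ t ≤ N`): `M_t = 𝓔′[X_t] + 𝓛♯[X_{t−1}] + G_t(X_1,…,X_{t−2})`. [folklore] -/
theorem two_slot_identity (t : ℕ) (ht : 3 ≤ t) (htN : t ≤ N) (y : UnitAddTorus (Fin 4)) :
    hierarchyCoeff j G f N P Q c t y =
      slotE j G (P 0) (c 0) (P t) (Q t) (c t) y
        + slotL j G (P 0) (P 1) (c 0) (c 1) (P (t - 1)) (Q (t - 1)) (c (t - 1)) y
        + lowerOrder j G P c t y := by
  rw [Unfold.hierarchyCoeff_of_le j G f N P Q c t (by omega) htN y, if_pos ht, if_pos (by omega : 2 ≤ t),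
    if_neg (by omega : t ≠ 1)]
  -- peel the triangular sums
  rw [sum_range_peel t (by omega) (fun a => ∑ l : Fin 3, (P a y) l • sDeriv l (P (t - 1 - a)) y),
    sum_range_peel (t + 1) (by omega) (fun a => ∑ l : Fin 3, (P a y) l • fDeriv j G l (P (t - a)) y),
    sum_range_peel t (by omega) (fun a => c a • sDeriv 2 (P (t - 1 - a)) y),
    sum_range_peel (t + 1) (by omega) (fun a => c a • fDeriv j G 2 (P (t - a)) y)]
  -- the inner fast sums `∑_{a < t-1} g (a+1)` still contain the levels `1` and `t-1`: peel once more
  rw [sum_range_peel (t + 1 - 2) (by omega) (fun a => ∑ l : Fin 3, (P (a + 1) y) l • fDeriv j G l (P (t - (a + 1))) y),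
    sum_range_peel (t + 1 - 2) (by omega) (fun a => c (a + 1) • fDeriv j G 2 (P (t - (a + 1))) y)]
  -- normalise the index arithmetic
  have e1 : t - 1 - 0 = t - 1 := by omega
  have e2 : t - 1 - (t - 1) = 0 := by omega
  have e3 : t - 0 = t := by omega
  have e4 : t + 1 - 1 = t := by omega
  have e5 : t - t = 0 := by omega
  have e6 : t - (0 + 1) = t - 1 := by omega
  have e7 : t + 1 - 2 - 1 + 1 = t - 1 := by omega
  have e8 : t - (t - 1) = 1 := by omega
  have e9 : t + 1 - 2 - 2 = t - 3 := by omega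
  simp only [e1, e2, e3, e4, e5, e6, e7, e8, e9]
  rw [toLp_add_fun (fun i => sDeriv i (Q (t - 1)) y) (fun i => fDeriv j G i (Q t) y)]
  unfold slotE slotL lowerOrder
  abel

/-- **The two-slot identity at order two** (`2 ≤ N`), with Euler's correction: the quadratic self-term
`B(X_1,X_1) = (P_1·k)∂_θP_1 − c_1k_2∂_θP_1` occurs once in `M_2` but twice in `𝓛♯[X_1]`, and the only lower-order datum is the
viscous cross term of `P_0`. [folklore] -/
theorem two_slot_identity_two (h2N : 2 ≤ N) (y : UnitAddTorus (Fin 4)) :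
    hierarchyCoeff j G f N P Q c 2 y =
      slotE j G (P 0) (c 0) (P 2) (Q 2) (c 2) y
        + slotL j G (P 0) (P 1) (c 0) (c 1) (P 1) (Q 1) (c 1) y
        - ((∑ l : Fin 3, (P 1 y) l • fDeriv j G l (P 1) y) - c 1 • fDeriv j G 2 (P 1) y)
        - (∑ i : Fin 3, (sDeriv i (fDeriv j G i (P 0)) y + fDeriv j G i (sDeriv i (P 0)) y)) := by
  rw [Unfold.hierarchyCoeff_of_le j G f N P Q c 2 (by norm_num) h2N y, if_neg (by norm_num : ¬ (3 ≤ 2)),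
    if_pos le_rfl, if_neg (by norm_num : (2 : ℕ) ≠ 1)]
  simp only [Finset.sum_range_succ, Finset.sum_range_zero, zero_add, Nat.sub_zero,
    show 2 - 1 - 1 = 0 from rfl, show 2 - 1 = 1 from rfl]
  rw [toLp_add_fun (fun i => sDeriv i (Q 1) y) (fun i => fDeriv j G i (Q 2) y)]
  unfold slotE slotL
  abel

end TwoSlot

/-! ## §3 The registered tools sub-stub -/

/-- **stub_hierarchyWTwoSlot** (registered tools sub-stub of stmt-AnomalousDissipation-16293; the two identities of this file). [folklore] -/
theorem stub_hierarchyWTwoSlot : (∀ (j : Fin 3 → ℤ) (G : UnitAddTorus (Fin 3) → ℝ) (f : UnitAddTorus (Fin 3) → EuclideanSpace ℝ (Fin 3)) (N : ℕ) (P : ℕ → UnitAddTorus (Fin 4) → EuclideanSpace ℝ (Fin 3)) (Q : ℕ → UnitAddTorus (Fin 4) → ℝ) (c : ℕ → ℝ) (t : ℕ), 3 ≤ t → t ≤ N → ∀ y : UnitAddTorus (Fin 4), hierarchyCoeff j G f N P Q c t y = slotE j G (P 0) (c 0) (P t) (Q t) (c t) y + slotL j G (P 0) (P 1) (c 0) (c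 1) (P (t - 1)) (Q (t - 1)) (c (t - 1)) y + lowerOrder j G P c t y) ∧ (∀ (j : Fin 3 → ℤ) (G : UnitAddTorus (Fin 3) → ℝ) (f : UnitAddTorus (Fin 3) → EuclideanSpace ℝ (Fin 3)) (N : ℕ) (P : ℕ → UnitAddTorus (Fin 4) → EuclideanSpace ℝ (Fin 3)) (Q : ℕ → UnitAddTorus (Fin 4) → ℝ) (c : ℕ → ℝ), 2 ≤ N → ∀ y : UnitAddTorus (Fin 4), hierarchyCoeff j G f N P Q c 2 y = slotE j G (P 0) (c 0) (P 2) (Q 2) (c 2) y + slotL j G (P 0) (P 1) (c 0) (c 1) (P 1) (Q 1) (c 1) y - ((∑ l : Fin 3, (P 1 y) l • fDeriv j G l (P 1) y) - c 1 • fDeriv j G 2 (P 1) y) - (∑ i : Fin 3, (sDeriv i (fDeriv j G i (P 0)) y + fDeriv j G i (sDeriv i (P 0)) y))) :=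
  ⟨fun j G f N P Q c t ht htN y => two_slot_identity j G f N P Q c t ht htN y,
    fun j G f N P Q c h2N y => two_slot_identity_two j G f N P Q c h2N y⟩

end Summit.AnomalousDissipation.AnomalousDissipation.Theorems.TaylorWaveQuasiSteady

end
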